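import Summits.BirchSwinnertonDyer.Rank1Residual.Additive.KatoDescentIntegralH1KummerIndex
import Summits.BirchSwinnertonDyer.BirchSwinnertonDyer.Theorems.CongruentShaFreeCutIntegralH1RankLeOne
import HarnessLib

set_option autoImplicit false

/-!
# KUMMER SATURATION of `H¹(ℤ[1/p], T_pW)` in rank one: every integral class is a `p`-ADIC MULTIPLE of the `T_p`-adic
# Kummer class `κ_∞(P)` of the generator — potss (R1-a) in the tree's currency; hence `v(log_ω P) ≤ v₀ ≤ v(log_ω P) + c`
# for the normalisation `φ(A) = p^{v₀}ℤ_p` of the Kummer-log functional (seat `bsd-cm-prr-ty1` g10, cell `bsd-cm`;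
# theorems only: no definition, no named fact, no instance, no `sorry`)

Brick (c), step 2 of the COUNT-EC⁰ / COUNT-FINE⁰ lane of stub 3 `stub_rankOneCountReadingKato` (19945 `kato_perrin_riou_zp` v4 /
19223 `kato_perrin_riou_istar` v4 = potss HELD 27322), planner D451 (3) / D468.  The print chain for the compact Poitou–Tate
count (potss `KMC-DESCENT-MEMO` §4 (R1-a)…(R1-f)) starts with (R1-a) «`𝔥 := H¹(ℤ[1/p], j_*T) = p^a · ℤ_p κ(P)`» (referee
GAP-check ask «`κ(P)` generates `H¹(G_S, T)`»).  This file proves its SATURATION half — every class of `A = integralH1 …` is a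
`ℤ_p`-multiple of `κ_∞(P)` — from the torsion-freeness of the Tate module of `H¹(ℚ, W)`:
* §1 `torsionH1ToH1_ofTopSubgroup_reduceTorsionH1` / `torsionH1ToH1_reduceH1Pk_eq_pow_smul`: along the `p_*`-tower the
  image of `red_{p^k} z` in `H¹(ℚ, W)` is `p^m` times that of `red_{p^{k+m}} z`; so if `p^m • z = μ • κ_∞(Q)` every reduction
  of `z` dies in `H¹(ℚ, W)` and is a finite-level Kummer class `κ_{p^k}(Q_k)` (exactness of the Kummer sequence, tree
  `mem_range_kummerMapTorsion_of_torsionH1ToH1_eq_zero`): `exists_kummerMapTorsion_eq_of_pow_smul_eq`.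
* §2 Saturation: for `P` a generator modulo torsion and `p ∤ #W(ℚ)_tors`, `κ_{p^k}` kills the torsion, `red_{p^k} z =
  n_k • κ_{p^k}(P)` with integers `n_k`, and the compactness argument of cn100's (R1) gives ONE `ν ∈ ℤ_p` with
  `z = ν • κ_∞(P)` (`exists_eq_smul_of_pow_smul_eq`).
* The rows (`W` globally minimal, rank `1`, `Ш[p^∞]` finite, `p ∤ #W(ℚ)_tors`: every integral class IS `ν • κ_∞(P)`, and
  `v(log_ω P) ≤ v₀ ≤ v(log_ω P) + c`) are the sequel file `KatoDescentGlobalKummerSaturationRows`.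

HONEST FRAMING: Galois-cohomology bookkeeping over tree theorems (Kummer theory AEC VIII.§2, Rubin B.2.3, cn100's (R1), bricks
(a′)/(b)); no named fact, no definition; nothing about `𝐇²`, the fine Selmer group, the Perrin-Riou formula or BSD is proved.
PARTITION: RANK axis × Kato–Perrin-Riou road (stub 3 of 19945/19223); closes no item.
References: [SilvermanAEC2009] VIII.§2, X.§4; [Rubin2000] App. B Prop. B.2.3; [PerrinRiou1987BSMF] §0; [Kato2004Asterisque]
§13.8, §14.1, §14.18; [BlochKato1990] Ex. 3.11; [MilneADT2006] I §6.
-/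


noncomputable section

open scoped Classical NumberField ContRepresentation

open WeierstrassCurve Field IsDedekindDomain NumberField CategoryTheory Literature.NumberTheory.EllipticCurves
  Literature.NumberTheory.EllipticCurves.Kato2004 Literature.NumberTheory.GaloisRepresentations
  Literature.NumberTheory.EllipticCurves.Kato2004.EulerSystemValues
  Summit.BirchSwinnertonDyer.BirchSwinnertonDyer.Theorems.IntegralH1LayerZeroTop
  Summit.BirchSwinnertonDyer.BirchSwinnertonDyer.Theorems.CongruentShaFreeCutIntegralH1RankLeOne
open WeierstrassCurve (geomPoints geomTorsion galH1Torsion kummerMapTorsion torsionH1ToH1)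

universe u

namespace Summit.BirchSwinnertonDyer.Rank1Residual.Additive.GlobalKummer

/-! ## §1 `H¹(ℚ, W[p^k]) → H¹(ℚ, W)` along the `p_*`-tower: the Tate module of `H¹(ℚ, W)` has no torsion -/

section Tower

variable (W : WeierstrassCurve ℚ) [W.IsElliptic] (p : ℕ) [Fact p.Prime]

omit [W.IsElliptic] [Fact p.Prime] in
/-- **`H¹(⊤, W[p^{k+1}]) →p_* H¹(⊤, W[p^k]) →ofTop H¹(ℚ, W[p^k]) → H¹(ℚ, W)` is `p` times
`H¹(⊤, W[p^{k+1}]) →ofTop H¹(ℚ, W[p^{k+1}]) → H¹(ℚ, W)`**: on cocycles both are `σ ↦ p • φ(σ)` read in `W(ℚ̄)`.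
[cite: PerrinRiou1987BSMF, §0 (p. 401)] [cite: SilvermanAEC2009, VIII.§2 (p. 190–191)] -/
theorem torsionH1ToH1_ofTopSubgroup_reduceTorsionH1 (k : ℕ)
    (w : H1 (W.torsionGaloisModule ((p : ℤ) ^ (k + 1))) ⊤) :
    torsionH1ToH1 W ((p : ℤ) ^ k)
        ((ofTopSubgroup (W.torsionGaloisModule ((p : ℤ) ^ k)).toTopRep 1).hom (W.reduceTorsionH1 p k ⊤ w)) =
      (p : ℤ) • torsionH1ToH1 W ((p : ℤ) ^ (k + 1))
        ((ofTopSubgroup (W.torsionGaloisModule ((p : ℤ) ^ (k + 1))).toTopRep 1).hom w) := by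
  obtain ⟨φ, rfl⟩ := oneCocycleClass_surjective _ w
  rw [reduceTorsionH1_oneCocycleClass]
  have hc : ∀ (n : ℤ) (ψ : contOneCocycles (subgroupRep (W.torsionGaloisModule n).toTopRep ⊤)),
      (ofTopSubgroup (W.torsionGaloisModule n).toTopRep 1).hom (oneCocycleClass _ ψ) =
        ContinuousCohomology.map toTopSubgroupHom (X := subgroupRep (W.torsionGaloisModule n).toTopRep ⊤)
          (Y := (W.torsionGaloisModule n).toTopRep)
          (TopRep.ofHom ⟨ContinuousLinearMap.id ℤ (geomTorsion W n), fun _ => rfl⟩) 1 (oneCocycleClass _ ψ) :=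
    fun _ _ ↦ rfl
  rw [hc, hc, map_oneCocycleClass, map_oneCocycleClass, torsionH1ToH1_eq_resH1Hom, torsionH1ToH1_eq_resH1Hom]
  change resH1Hom _ _ _ (oneCocycleClass (discreteTopRep (absoluteGaloisGroup ℚ) (geomTorsion W ((p : ℤ) ^ k))) _) =
    (p : ℤ) • resH1Hom _ _ _
      (oneCocycleClass (discreteTopRep (absoluteGaloisGroup ℚ) (geomTorsion W ((p : ℤ) ^ (k + 1)))) _)
  rw [resH1Hom_oneCocycleClass, resH1Hom_oneCocycleClass]
  rw [← Int.cast_smul_eq_zsmul ℤ (p : ℤ), ← oneCocycleClass_smul]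
  exact congrArg _ (Subtype.ext (ContinuousMap.ext fun σ => rfl))

/-- The level-`p^k` surjectivity hypothesis of `kummerMapTorsion` over `ℚ` (divisibility of `W(ℚ̄)`), named once.
[cite: SilvermanAEC2009, VIII.§2 (p. 190)] -/
theorem zsmul_pow_surjective (k : ℕ) (R : geomPoints W) : ∃ Q : geomPoints W, ((p : ℤ) ^ k) • Q = R :=
  zsmul_geomPoints_surjective_holds W (pow_ne_zero k (Int.natCast_ne_zero.mpr (Fact.out : p.Prime).ne_zero)) R

variable [ContinuousSMul ℤ_[p] (W.tateModule p)]

/-- **Along the reductions of ONE class `z ∈ H¹(⊤, T_pW)`**: the image of `red_{p^k} z` in `H¹(ℚ, W)` is `p^m` times the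
image of `red_{p^{k+m}} z` (`p_* ∘ red_{p^{k+1}} = red_{p^k}`, tree `reduceTorsionH1_reduceH1Pk`, iterated).
[cite: PerrinRiou1987BSMF, §0 (p. 401)] [cite: Rubin2000, App. B Prop. B.2.3] -/
theorem torsionH1ToH1_reduceH1Pk_eq_pow_smul (z : H1 (tateRep W p) ⊤) (k m : ℕ) :
    torsionH1ToH1 W ((p : ℤ) ^ k)
        ((ofTopSubgroup (W.torsionGaloisModule ((p : ℤ) ^ k)).toTopRep 1).hom (reduceH1Pk W p k ⊤ z)) =
      (p : ℤ) ^ m • torsionH1ToH1 W ((p : ℤ) ^ (k + m))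
        ((ofTopSubgroup (W.torsionGaloisModule ((p : ℤ) ^ (k + m))).toTopRep 1).hom (reduceH1Pk W p (k + m) ⊤ z)) := by
  induction m with
  | zero => rw [pow_zero, one_zsmul]; rfl
  | succ m ih =>
      change _ = (p : ℤ) ^ (m + 1) • torsionH1ToH1 W ((p : ℤ) ^ ((k + m) + 1))
        ((ofTopSubgroup (W.torsionGaloisModule ((p : ℤ) ^ ((k + m) + 1))).toTopRep 1).hom
          (reduceH1Pk W p ((k + m) + 1) ⊤ z))
      rw [ih, pow_succ, mul_zsmul, ← torsionH1ToH1_ofTopSubgroup_reduceTorsionH1 W p (k + m),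
        reduceTorsionH1_reduceH1Pk]

/-- **If `p^m • z = μ • κ_∞(Q)` then every reduction of `z` dies in `H¹(ℚ, W)`.**  For `x` with
`ofTop(red_{p^j} x) = κ_{p^j}(Q)` for all `j` (the `T_p`-adic Kummer class of `Q`) and `p ^ m • z = μ • x` (`μ ∈ ℤ_p`): the image
of `red_{p^k} z` is `p^m` times that of `red_{p^{k+m}} z` (previous lemma), i.e. the image of `red_{p^{k+m}}(p^m • z) =
red_{p^{k+m}}(μ • x) = (μ mod p^{k+m}) • κ_{p^{k+m}}(Q)`, and Kummer classes die in `H¹(ℚ, W)` (tree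
`torsionH1ToH1_kummerMapTorsion`). [cite: SilvermanAEC2009, VIII.§2 (p. 190–191)] [cite: Kato2004Asterisque, §13.8 (p. 228)] -/
theorem torsionH1ToH1_reduceH1Pk_eq_zero_of_pow_smul_eq {Q : W.toAffine.Point} {x z : H1 (tateRep W p) ⊤}
    (hx : ∀ j : ℕ,
      (ofTopSubgroup (W.torsionGaloisModule ((p : ℤ) ^ j)).toTopRep 1).hom (reduceH1Pk W p j ⊤ x) =
        kummerMapTorsion W ((p : ℤ) ^ j) (zsmul_pow_surjective W p j) Q)
    {m : ℕ} {μ : ℤ_[p]} (hz : p ^ m • z = μ • x) (k : ℕ) :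
    torsionH1ToH1 W ((p : ℤ) ^ k)
        ((ofTopSubgroup (W.torsionGaloisModule ((p : ℤ) ^ k)).toTopRep 1).hom (reduceH1Pk W p k ⊤ z)) = 0 := by
  rw [torsionH1ToH1_reduceH1Pk_eq_pow_smul W p z k m]
  set y : galH1Torsion W ((p : ℤ) ^ (k + m)) :=
    (ofTopSubgroup (W.torsionGaloisModule ((p : ℤ) ^ (k + m))).toTopRep 1).hom (reduceH1Pk W p (k + m) ⊤ z) with hy
  -- `p^m • y` is the reduction of `p^m • z`
  have h3 : (p ^ m • y : galH1Torsion W ((p : ℤ) ^ (k + m))) =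
      (ofTopSubgroup (W.torsionGaloisModule ((p : ℤ) ^ (k + m))).toTopRep 1).hom
        (reduceH1Pk W p (k + m) ⊤ (p ^ m • z)) := by
    rw [map_nsmul, map_nsmul]
    rfl
  -- the reduction of `μ • x` is `(μ mod p^{k+m}) • κ_{p^{k+m}}(Q)`
  have h4 : (ofTopSubgroup (W.torsionGaloisModule ((p : ℤ) ^ (k + m))).toTopRep 1).hom
        (reduceH1Pk W p (k + m) ⊤ (μ • x)) =
      (PadicInt.appr μ (k + m) • kummerMapTorsion W ((p : ℤ) ^ (k + m)) (zsmul_pow_surjective W p (k + m)) Q :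
        galH1Torsion W ((p : ℤ) ^ (k + m))) := by
    rw [reduceH1Pk_smul_eq_appr_nsmul, map_nsmul, hx]
    rfl
  have h5 : (p : ℤ) ^ m • torsionH1ToH1 W ((p : ℤ) ^ (k + m)) y =
      torsionH1ToH1 W ((p : ℤ) ^ (k + m)) (p ^ m • y) := by
    rw [map_nsmul, ← natCast_zsmul, Nat.cast_pow]
  rw [h5, h3, hz, h4, map_nsmul, WeierstrassCurve.torsionH1ToH1_kummerMapTorsion, nsmul_zero]

/-- **Hence every reduction of `z` is a finite-level Kummer class**: `ofTop(red_{p^k} z) = κ_{p^k}(Q_k)` for some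
`Q_k ∈ W(ℚ)` (exactness of the Kummer sequence at `H¹(ℚ, W[p^k])`, tree `mem_range_kummerMapTorsion_of_torsionH1ToH1_eq_zero`).
[cite: SilvermanAEC2009, VIII.§2 (p. 190–191)] -/
theorem exists_kummerMapTorsion_eq_of_pow_smul_eq {Q : W.toAffine.Point} {x z : H1 (tateRep W p) ⊤}
    (hx : ∀ j : ℕ,
      (ofTopSubgroup (W.torsionGaloisModule ((p : ℤ) ^ j)).toTopRep 1).hom (reduceH1Pk W p j ⊤ x) =
        kummerMapTorsion W ((p : ℤ) ^ j) (zsmul_pow_surjective W p j) Q)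
    {m : ℕ} {μ : ℤ_[p]} (hz : p ^ m • z = μ • x) (k : ℕ) :
    ∃ Qk : W.toAffine.Point,
      (ofTopSubgroup (W.torsionGaloisModule ((p : ℤ) ^ k)).toTopRep 1).hom (reduceH1Pk W p k ⊤ z) =
        kummerMapTorsion W ((p : ℤ) ^ k) (zsmul_pow_surjective W p k) Qk := by
  haveI : PerfectField ℚ := PerfectField.ofCharZero
  obtain ⟨Qk, hQk⟩ := WeierstrassCurve.mem_range_kummerMapTorsion_of_torsionH1ToH1_eq_zero W ((p : ℤ) ^ k)
    (zsmul_pow_surjective W p k) _ (torsionH1ToH1_reduceH1Pk_eq_zero_of_pow_smul_eq W p hx hz k)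
  exact ⟨Qk, hQk.symm⟩

end Tower

/-! ## §2 Saturation: `z = ν • κ_∞(P)` for ONE `ν ∈ ℤ_p` -/

section Saturation

variable (W : WeierstrassCurve ℚ) [W.IsElliptic] (p : ℕ) [Fact p.Prime]

omit [W.IsElliptic] in
/-- `κ_n(0) = 0`, read with the ambient group law of `W(ℚ)` (the type of the tree's `kummerMapTorsion`, stated over a general
field, carries the classical `DecidableEq`; the two decidability instances on `ℚ` agree — same device as
`kummerMapTorsion_add'`). [cite: SilvermanAEC2009, VIII.§2 (p. 190–191)] -/
theorem kummerMapTorsion_zero' {n : ℤ} (hdiv : ∀ P : geomPoints W, ∃ Q : geomPoints W, n • Q = P) :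
    kummerMapTorsion W n hdiv 0 = 0 := by
  have h := @ZeroHom.map_zero' _ _ (_) (_) (@AddMonoidHom.toZeroHom _ _ (_) (_) (kummerMapTorsion W n hdiv))
  change kummerMapTorsion W n hdiv _ = 0 at h
  convert h

omit [W.IsElliptic] in
/-- `ℕ`-linearity of the finite-level Kummer map (ambient group law). [cite: SilvermanAEC2009, VIII.§2 (p. 190–191)] -/
theorem kummerMapTorsion_nsmul' {n : ℤ} (hdiv : ∀ P : geomPoints W, ∃ Q : geomPoints W, n • Q = P) (c : ℕ)
    (a : W.toAffine.Point) : kummerMapTorsion W n hdiv (c • a) = c • kummerMapTorsion W n hdiv a := by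
  induction c with
  | zero => rw [zero_nsmul, zero_nsmul, kummerMapTorsion_zero']
  | succ c ih => rw [succ_nsmul, succ_nsmul, kummerMapTorsion_add', ih]

omit [W.IsElliptic] in
/-- `κ_n(−a) = −κ_n(a)` (ambient group law). [cite: SilvermanAEC2009, VIII.§2 (p. 190–191)] -/
theorem kummerMapTorsion_neg' {n : ℤ} (hdiv : ∀ P : geomPoints W, ∃ Q : geomPoints W, n • Q = P)
    (a : W.toAffine.Point) : kummerMapTorsion W n hdiv (-a) = -kummerMapTorsion W n hdiv a := by
  rw [eq_neg_iff_add_eq_zero, ← kummerMapTorsion_add', neg_add_cancel, kummerMapTorsion_zero']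

omit [W.IsElliptic] in
/-- `ℤ`-linearity of the finite-level Kummer map (ambient group law). [cite: SilvermanAEC2009, VIII.§2 (p. 190–191)] -/
theorem kummerMapTorsion_zsmul' {n : ℤ} (hdiv : ∀ P : geomPoints W, ∃ Q : geomPoints W, n • Q = P) (c : ℤ)
    (a : W.toAffine.Point) : kummerMapTorsion W n hdiv (c • a) = c • kummerMapTorsion W n hdiv a := by
  cases c with
  | ofNat c => rw [Int.ofNat_eq_natCast, natCast_zsmul, natCast_zsmul, kummerMapTorsion_nsmul']
  | negSucc c => rw [negSucc_zsmul, negSucc_zsmul, kummerMapTorsion_neg', kummerMapTorsion_nsmul']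

/-- **`κ_{p^k}` kills the rational torsion when `p ∤ #W(ℚ)_tors`**: a point `t` of finite order `N` with `p ∤ N`
(`N ∣ #W(ℚ)_tors`, Lagrange) is `u • p^k • t` for some `u` (`p^k` is invertible modulo `N`), and `p^k • H¹(ℚ, W[p^k]) = 0`.
[cite: SilvermanAEC2009, VIII.§2 (p. 190–191) and VII.3] -/
theorem kummerMapTorsion_eq_zero_of_isOfFinAddOrder (htors : ¬ p ∣ W.torsionOrder) (k : ℕ)
    {t : W.toAffine.Point} (ht : IsOfFinAddOrder t) :
    kummerMapTorsion W ((p : ℤ) ^ k) (zsmul_pow_surjective W p k) t = 0 := by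
  have hp : p.Prime := Fact.out
  have hmem : t ∈ AddCommGroup.torsion W.toAffine.Point := ht
  have hdvd : addOrderOf t ∣ W.torsionOrder := by
    have h := addOrderOf_dvd_natCard (⟨t, hmem⟩ : AddCommGroup.torsion W.toAffine.Point)
    rw [AddSubgroup.addOrderOf_mk] at h
    unfold WeierstrassCurve.torsionOrder
    convert h
  have hcop : (p ^ k).Coprime (addOrderOf t) :=
    Nat.Coprime.pow_left k ((Nat.Prime.coprime_iff_not_dvd hp).mpr fun h ↦ htors (h.trans hdvd))
  obtain ⟨u, hu⟩ := exists_nsmul_eq_self_of_coprime hcop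
  have hkill : ∀ g : galH1Torsion W ((p : ℤ) ^ k), (p ^ k) • g = 0 := by
    have h := nsmul_galH1Torsion_natCast_eq_zero W (p ^ k)
    rw [Nat.cast_pow] at h
    exact h
  rw [← hu, kummerMapTorsion_nsmul', kummerMapTorsion_nsmul', hkill, nsmul_zero]

variable [ContinuousSMul ℤ_[p] (W.tateModule p)]

/-- **Levelwise: the reductions of `z` are INTEGER multiples of `κ_{p^k}(P)`** when `P` generates `W(ℚ)` modulo torsion,
`p ∤ #W(ℚ)_tors` and `p^m • z = μ • κ_∞(Q)`: `red_{p^k} z = κ_{p^k}(Q_k)` (§1), `Q_k = n_k • P + t_k` with `t_k` torsion,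
and `κ_{p^k}(t_k) = 0`. [cite: SilvermanAEC2009, VIII.§2 (p. 190–191)] [cite: Rubin2000, App. B Prop. B.2.3] -/
theorem exists_zsmul_kummerMapTorsion_eq_of_pow_smul_eq (htors : ¬ p ∣ W.torsionOrder) {P Q : W.toAffine.Point}
    (hgen : ∀ R : W.toAffine.Point, ∃ n : ℤ, IsOfFinAddOrder (R - n • P)) {x z : H1 (tateRep W p) ⊤}
    (hx : ∀ j : ℕ,
      (ofTopSubgroup (W.torsionGaloisModule ((p : ℤ) ^ j)).toTopRep 1).hom (reduceH1Pk W p j ⊤ x) =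
        kummerMapTorsion W ((p : ℤ) ^ j) (zsmul_pow_surjective W p j) Q)
    {m : ℕ} {μ : ℤ_[p]} (hz : p ^ m • z = μ • x) (k : ℕ) :
    ∃ n : ℤ,
      (ofTopSubgroup (W.torsionGaloisModule ((p : ℤ) ^ k)).toTopRep 1).hom (reduceH1Pk W p k ⊤ z) =
        n • kummerMapTorsion W ((p : ℤ) ^ k) (zsmul_pow_surjective W p k) P := by
  obtain ⟨Qk, hQk⟩ := exists_kummerMapTorsion_eq_of_pow_smul_eq W p hx hz k
  obtain ⟨n, ht⟩ := hgen Qk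
  refine ⟨n, ?_⟩
  rw [hQk, ← sub_add_cancel Qk (n • P), kummerMapTorsion_add', kummerMapTorsion_zsmul',
    kummerMapTorsion_eq_zero_of_isOfFinAddOrder W p htors k ht, zero_add]

/-- **SATURATION: `z = ν • κ_∞(P)` for ONE `ν ∈ ℤ_p`.**  For `P` generating `W(ℚ)` modulo torsion, `p ∤ #W(ℚ)_tors`,
`x_P`, `x_Q` the `T_p`-adic Kummer classes of `P`, `Q` and `p ^ m • z = μ • x_Q`: levelwise `red_{p^k} z = n_k • κ_{p^k}(P)`
(previous lemma), so the sets `{ν | red_{p^{k+1}}(z − ν • x_P) = 0}` are non-empty (`ν = n_{k+1}`), closed (membership depends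
on `ν mod p^{k+1}`) and decreasing; compactness of `ℤ_p` gives ONE `ν` with all reductions of `z − ν • x_P` zero, i.e.
`z = ν • x_P` (Rubin B.2.3 injectivity, tree `eq_zero_of_forall_reduceH1Pk_eq_zero`) — the compactness step verbatim as in
cn100's (R1) `exists_smul_add_smul_eq_zero_of_mem_integralH1`. [cite: Rubin2000, App. B Prop. B.2.3]
[cite: SilvermanAEC2009, VIII.§2 (p. 190–191)] [cite: Kato2004Asterisque, §13.8 (p. 228)] -/
theorem exists_eq_smul_of_pow_smul_eq (htors : ¬ p ∣ W.torsionOrder) {P Q : W.toAffine.Point}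
    (hgen : ∀ R : W.toAffine.Point, ∃ n : ℤ, IsOfFinAddOrder (R - n • P)) {xP xQ z : H1 (tateRep W p) ⊤}
    (hxP : ∀ j : ℕ,
      (ofTopSubgroup (W.torsionGaloisModule ((p : ℤ) ^ j)).toTopRep 1).hom (reduceH1Pk W p j ⊤ xP) =
        kummerMapTorsion W ((p : ℤ) ^ j) (zsmul_pow_surjective W p j) P)
    (hxQ : ∀ j : ℕ,
      (ofTopSubgroup (W.torsionGaloisModule ((p : ℤ) ^ j)).toTopRep 1).hom (reduceH1Pk W p j ⊤ xQ) =
        kummerMapTorsion W ((p : ℤ) ^ j) (zsmul_pow_surjective W p j) Q)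
    {m : ℕ} {μ : ℤ_[p]} (hz : p ^ m • z = μ • xQ) :
    ∃ ν : ℤ_[p], z = ν • xP := by
  have hp : p.Prime := Fact.out
  choose n hn using fun k ↦ exists_zsmul_kummerMapTorsion_eq_of_pow_smul_eq W p htors hgen hxQ hz k
  set Λ : ℕ → Set ℤ_[p] := fun k ↦ {ν | reduceH1Pk W p (k + 1) ⊤ (z - ν • xP) = 0} with hΛ
  -- (F1) non-empty: `ν = n_{k+1}`
  have hne : ∀ k, (Λ k).Nonempty := by
    intro k
    refine ⟨(n (k + 1) : ℤ_[p]), ?_⟩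
    show reduceH1Pk W p (k + 1) ⊤ (z - ((n (k + 1) : ℤ) : ℤ_[p]) • xP) = 0
    apply eq_zero_of_ofTopSubgroup_eq_zero
    rw [Int.cast_smul_eq_zsmul, map_sub, map_sub, map_zsmul, map_zsmul, hn (k + 1), hxP (k + 1)]
    exact sub_eq_zero.mpr rfl
  -- (F2) decreasing
  have hdec : ∀ k, Λ (k + 1) ⊆ Λ k := fun k ν hν ↦ reduceH1Pk_eq_zero_of_succ W p _ _ hν
  -- (F3) closed: membership depends only on `ν mod p^{k+1}`
  have hcl : ∀ k, IsClosed (Λ k) := by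
    intro k
    refine isClosed_of_closure_subset fun ν hν ↦ ?_
    have hε : (0 : ℝ) < (p : ℝ) ^ (-(k + 1 : ℕ) : ℤ) := zpow_pos (by exact_mod_cast hp.pos) _
    obtain ⟨ν₀, hν₀, hdist⟩ := Metric.mem_closure_iff.mp hν _ hε
    have hmem : ν - ν₀ ∈ Ideal.span {(p : ℤ_[p]) ^ (k + 1)} := by
      rw [← PadicInt.norm_le_pow_iff_mem_span_pow]
      rw [dist_eq_norm] at hdist
      exact hdist.le
    obtain ⟨ν', hν'⟩ := Ideal.mem_span_singleton'.mp hmem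
    have hνeq : ν = ν₀ + (p : ℤ_[p]) ^ (k + 1) * ν' := by rw [mul_comm, hν']; ring
    show reduceH1Pk W p (k + 1) ⊤ (z - ν • xP) = 0
    have h0 : reduceH1Pk W p (k + 1) ⊤ (z - ν₀ • xP) = 0 := hν₀
    rw [hνeq, add_smul, ← sub_sub, map_sub, h0, mul_smul, reduceH1Pk_pow_smul, sub_zero]
  -- (F4) compactness of `ℤ_p` and Rubin's injectivity
  obtain ⟨ν, hν⟩ := IsCompact.nonempty_iInter_of_sequence_nonempty_isCompact_isClosed Λ hdec hne
    (hcl 0).isCompact hcl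
  refine ⟨ν, sub_eq_zero.mp (eq_zero_of_forall_reduceH1Pk_eq_zero W p ⊤ _ fun j ↦ ?_)⟩
  have hall : ∀ k, reduceH1Pk W p (k + 1) ⊤ (z - ν • xP) = 0 := fun k ↦ by
    have h := Set.mem_iInter.mp hν k
    exact h
  cases j with
  | zero => exact reduceH1Pk_eq_zero_of_succ W p 0 _ (hall 0)
  | succ j => exact hall j

end Saturation

end Summit.BirchSwinnertonDyer.Rank1Residual.Additive.GlobalKummer
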